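import Literature.MathematicalPhysics.QuantumFieldTheory.Balaban1983to89.Node00.Record11CarriersB8
import Literature.MathematicalPhysics.QuantumFieldTheory.Balaban1983to89.Node00.Record11Beta

/-!
# NODE 00 (YM-PLAN Track A) — THE DATUM-LEVEL KEY OF THE TWO CARRIER RECORDS AT STAGE 11: «`D` is a datum of record, Stage 11» (`IsDatumOfRecord₁₁C`), THE CANONICAL
# STAGE-11 PARAMETER OF SUCH A DATUM (`IsDatumOfRecord₁₁C.params ∕ .provisos`, by choice), its faces, and the world companions in `₁₁C` ∕ `₁₁CB10YZW`

NODE 00 RECORD MODULE (cell `pub-ymgap`, seat `pub-ymgap-node00-def-RR-2` = second reader ∕ instance side of the RATE-RECORD HOME keyed to `Record11`, director-ym R141 (A);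
dag-lead WORDS-99: the home is (N) `Node00/` objects of record · (T-RATE) `Thm/BalabanUVNodesRateCarriersOfRecord11` · (T-SPINE) `Thm/BalabanUVNodesSpineCarriersOfRecord11`).
APPEND-ONLY: a NEW module importing `Node00/Record11CarriersB8` (hence `Record11Carriers`, `Record11`) and def-B's `Node00/Record11Beta` (`betaOfRecord₁₁`); everything it reads is
CONSUMED BY NAME.

WHY THIS OBJECT.  The two carrier records of clusters K4 ∕ K5 — `RRec : RateRecordPred N`, `SRec : SpineRecordPred N`, Summits-side PARAMETERS of `Thm/BalabanUVNodesSpineRates`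
(:119) ∕ `Thm/BalabanUVNodesClustersCore` (:111) — are read JOINTLY by the N19′ edge of the K4→K5 join (`Thm/BalabanUVNodesN27AtRecordK4.spine_of_rateStubs_coreEdge` :64,
`…N27AtRecord11.spine_rec11C_of_rateStubs_coreEdge` :217: «`SRec F D g₀ os S → RRec F D g₀ os R → RatesAt D R → ∃ δ, NE7.Core S.l₀ … δ ∧ Summable δ`», for ANY pair
`(S, R)` the two records admit at the same `(F, D, g₀, os)`).  Keying each record by its OWN existential Stage-11 witness («`∃ θ hP, θ.Admissible ∧ D = datumOfRecord₁₁ F N θ hP ∧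
R = obj θ hP g₀ os`») admits INCOHERENT pairs — `S` the term classes of one parameter's expansion, `R` the rates of another's: `datumOfRecord₁₁` is not injective in the residual
data, so nothing relates them — and the N14 ∕ N18 pin-closers (`YMDAG.N14.s_N14_iff_of_pinned`, `YMDAG.N18.s_N18_of_pinned`) want the sub-bundles as FUNCTIONS of
`(F, D, g₀, os)`.  Both are met by keying every object of record to THE CANONICAL PARAMETER of the datum: `h.params := Classical.choose h` for `h : IsDatumOfRecord₁₁C F N D`,
with `h.provisos`, `h.admissible`, `h.eq_datumOfRecord₁₁ : D = datumOfRecord₁₁ F N h.params h.provisos`.  Every θ-level object of record `X θ hP g₀ os` ((N)'s, def-W1's,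
def-T's) then has ONE datum-level INSTANCE `X h.params h.provisos g₀ os` per `(F, D, g₀, os)`; the intended record shape is «`RRec₁₁ F D g₀ os R :↔ ∃ h : IsDatumOfRecord₁₁C F N D,
R = obj F h.params h.provisos g₀ os`» (an ∃ over a PROPOSITION: proof-irrelevant, one bundle), and a consumer proving its node AT EVERY admissible `θ` with provisos proves it
at the instance (`IsDatumOfRecord₁₁C.forall_params`).  `isDatumOfRecord₁₁C_iff_exists_world`: the datum class IS the `₁₁C` record class with the world forgotten, so K0
(`Record11Inhabited`) reads the same either way.

HONEST FRAMING.  Definitions of record + kernel bookkeeping (`Classical.choose`, `rfl`, ∃-repackaging); NOTHING of Bałaban's is asserted; no node is discharged; counts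
unmoved; one finite four-torus programme at fixed `ε` — NOT the continuum limit on ℝ⁴, NOT infinite volume, NOT OS, NOT a mass gap, NOT the Clay problem.  No `sorry` ∕
`axiom` ∕ `opaque` ∕ `instance` ∕ `notation`.  [Balaban1989LargeFieldII] = Commun. Math. Phys. **122** (1989) 355–392; [Balaban1987RG1] = Commun. Math. Phys. **109** (1987) 249–301.
-/
noncomputable section

namespace Literature.MathematicalPhysics.QuantumFieldTheory.Balaban1983to89.Node00

open T4Continuum DagBinding

/-! ## §1. «`D` is a datum of record, Stage 11» and its CANONICAL parameter -/

section DatumKey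

variable (F : T4Family) (N : ℕ) [NeZero N]

/-- **«`D` is a datum of record, Stage 11 (C-class)»**: SOME admissible Stage-11 parameter satisfying its displayed provisos has `D` as its datum of record — the
datum-level shadow of `IsRecordOfRecord₁₁C` (the world forgotten; `isDatumOfRecord₁₁C_iff_exists_world`). [cite: Balaban1989LargeFieldII, Thm 1 + (0.1) pp.355–356; Balaban1988Convergent, Thms 1–2 pp.262–263 (objects of record; bookkeeping)] -/
def IsDatumOfRecord₁₁C (D : FiniteEpsData F (SU N)) : Prop :=
  ∃ (θ : Stage11Params F N) (h : θ.Provisos₁₁), θ.Admissible ∧ D = datumOfRecord₁₁ F N θ h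

/-- Every admissible Stage-11 parameter with provisos yields a datum of record. [cite: Balaban1989LargeFieldII, Thm 1 + (0.1) pp.355–356 (bookkeeping)] -/
theorem isDatumOfRecord₁₁C_datumOfRecord₁₁ (θ : Stage11Params F N) (h : θ.Provisos₁₁) (hθ : θ.Admissible) :
    IsDatumOfRecord₁₁C F N (datumOfRecord₁₁ F N θ h) :=
  ⟨θ, h, hθ, rfl⟩

variable {F N}
variable {D : FiniteEpsData F (SU N)} {w : WorldP}

/-- A Stage-11 record's datum is a Stage-11 datum of record. [cite: Balaban1989LargeFieldII, Thm 1 p.355 (bookkeeping)] -/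
theorem isDatumOfRecord₁₁C_of_isRecordOfRecord₁₁C (h : IsRecordOfRecord₁₁C F N D w) : IsDatumOfRecord₁₁C F N D :=
  exists_provisos_of_isRecordOfRecord₁₁C h

/-- … likewise from the carrier-pinned record classes. [cite: Balaban1989LargeFieldII, Thm 1 p.355 (bookkeeping)] -/
theorem isDatumOfRecord₁₁C_of_isRecordOfRecord₁₁CB10YZW (h : IsRecordOfRecord₁₁CB10YZW F N D w) : IsDatumOfRecord₁₁C F N D :=
  isDatumOfRecord₁₁C_of_isRecordOfRecord₁₁C (isRecordOfRecord₁₁C_of_isRecordOfRecord₁₁CB10YZW h)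

/-- … and from the five-pin class with `b8` surviving (through its same-datum companion). [cite: Balaban1989LargeFieldII, Thm 1 p.355 (bookkeeping)] -/
theorem isDatumOfRecord₁₁C_of_isRecordOfRecord₁₁CB10YZWB8 (h : IsRecordOfRecord₁₁CB10YZWB8 F N D w) : IsDatumOfRecord₁₁C F N D := by
  obtain ⟨w', hw', -⟩ := companion_of_isRecordOfRecord₁₁CB10YZWB8 h
  exact isDatumOfRecord₁₁C_of_isRecordOfRecord₁₁CB10YZW hw'

/-- **DATUM OF RECORD ⟺ RECORD AT SOME WORLD.** [cite: Balaban1989LargeFieldII, Thm 1 + (0.1) pp.355–356 (bookkeeping)] -/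
theorem isDatumOfRecord₁₁C_iff_exists_world : IsDatumOfRecord₁₁C F N D ↔ ∃ w : WorldP, IsRecordOfRecord₁₁C F N D w := by
  constructor
  · rintro ⟨θ, hP, hθ, rfl⟩
    obtain ⟨w, hw, -⟩ := exists_world_isRecordOfRecord₁₁C F N θ hP hθ ⟨hθ.toStage9.gamma_pos, le_rfl⟩
    exact ⟨w, hw⟩
  · rintro ⟨w, hw⟩
    exact isDatumOfRecord₁₁C_of_isRecordOfRecord₁₁C hw

/-- **THE CANONICAL STAGE-11 PARAMETER OF A DATUM OF RECORD** (choice) — the ONE key both carrier records of clusters K4 ∕ K5 are read at.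
[cite: Balaban1989LargeFieldII, Thm 1 + (0.1) pp.355–356 (bookkeeping)] -/
def IsDatumOfRecord₁₁C.params (h : IsDatumOfRecord₁₁C F N D) : Stage11Params F N :=
  Classical.choose h

/-- Its provisos. [cite: Balaban1989LargeFieldII, Thm 1 p.355 (bookkeeping)] -/
theorem IsDatumOfRecord₁₁C.provisos (h : IsDatumOfRecord₁₁C F N D) : h.params.Provisos₁₁ :=
  (Classical.choose_spec h).fst

/-- Its admissibility. [cite: Balaban1989LargeFieldII, Thm 1 p.355 (bookkeeping)] -/
theorem IsDatumOfRecord₁₁C.admissible (h : IsDatumOfRecord₁₁C F N D) : h.params.Admissible :=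
  (Classical.choose_spec h).snd.1

/-- **The datum IS the datum of record of its canonical parameter.** [cite: Balaban1989LargeFieldII, Thm 1 p.355 (bookkeeping)] -/
theorem IsDatumOfRecord₁₁C.eq_datumOfRecord₁₁ (h : IsDatumOfRecord₁₁C F N D) : D = datumOfRecord₁₁ F N h.params h.provisos :=
  (Classical.choose_spec h).snd.2

/-- The canonical parameter's coupling window is positive. [cite: Balaban1987RG1, (0.21) p.256 (bookkeeping)] -/
theorem IsDatumOfRecord₁₁C.gamma_pos (h : IsDatumOfRecord₁₁C F N D) : 0 < h.params.γ :=
  h.admissible.toStage9.gamma_pos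

/-- **WHAT A CONSUMER PROVES ⟹ WHAT THE INSTANCE CARRIES**: a property of the objects of record established at EVERY admissible Stage-11 parameter with provisos
holds at the canonical parameter of every datum of record. [cite: Balaban1989LargeFieldII, Thm 1 p.355 (bookkeeping)] -/
theorem IsDatumOfRecord₁₁C.forall_params {P : (D : FiniteEpsData F (SU N)) → (θ : Stage11Params F N) → θ.Provisos₁₁ → Prop}
    (hP : ∀ (θ : Stage11Params F N) (hθ : θ.Provisos₁₁), θ.Admissible → P (datumOfRecord₁₁ F N θ hθ) θ hθ) (h : IsDatumOfRecord₁₁C F N D) :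
    P D h.params h.provisos := by
  have := hP h.params h.provisos h.admissible
  rwa [← h.eq_datumOfRecord₁₁] at this

/-- **WORLD COMPANION IN `₁₁C` AT ANY WINDOW BELOW THE CANONICAL ONE**: for `0 < γw ≤ h.params.γ` some world makes `(D, w)` a Stage-11 record with `w.γ = γw` — what
`…N17AtRecord11.s_N17_of_rec₁₁C`'s home-keying binder («`RRec … R → ∃ w, IsRecordOfRecord₁₁C F N D w ∧ R.u3.γ = w.γ`») consumes once `R.u3.γ` is pinned in that range.
[cite: Balaban1989LargeFieldII, Thm 1 + (0.1) pp.355–356 (bookkeeping)] -/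
theorem IsDatumOfRecord₁₁C.exists_world (h : IsDatumOfRecord₁₁C F N D) {γw : ℝ} (hγw : 0 < γw ∧ γw ≤ h.params.γ) :
    ∃ w : WorldP, IsRecordOfRecord₁₁C F N D w ∧ w.γ = γw := by
  obtain ⟨w, hw, hγ⟩ := exists_world_isRecordOfRecord₁₁C F N h.params h.provisos h.admissible hγw
  exact ⟨w, h.eq_datumOfRecord₁₁ ▸ hw, hγ⟩

/-- … in particular at the canonical window `h.params.γ` itself. [cite: Balaban1989LargeFieldII, Thm 1 + (0.1) pp.355–356 (bookkeeping)] -/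
theorem IsDatumOfRecord₁₁C.exists_world_gamma (h : IsDatumOfRecord₁₁C F N D) :
    ∃ w : WorldP, IsRecordOfRecord₁₁C F N D w ∧ w.γ = h.params.γ :=
  h.exists_world ⟨h.gamma_pos, le_rfl⟩

/-- **WORLD COMPANION IN `₁₁CB10YZW`** (four carrier groups pinned, the three residual layers supplied by the caller — all three types are inhabited:
`nonempty_residZ`, `nonempty_residW`, and the zero operator layer) at any window below the canonical one. [cite: Balaban1989LargeFieldII, Thm 1 + (0.1) pp.355–356 (bookkeeping)] -/
theorem IsDatumOfRecord₁₁C.exists_world_B10YZW (h : IsDatumOfRecord₁₁C F N D) (Mstar : ℕ) (ops : OpsY N h.params.toStage3Params Mstar) (ζ : ResidZ F N)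
    (lamW : ResidW F N) {γw : ℝ} (hγw : 0 < γw ∧ γw ≤ h.params.γ) :
    ∃ w : WorldP, IsRecordOfRecord₁₁CB10YZW F N D w ∧ w.γ = γw := by
  obtain ⟨w, hw, hγ⟩ := exists_world_isRecordOfRecord₁₁CB10YZW F N h.params h.provisos h.admissible Mstar ops ζ lamW hγw
  exact ⟨w, h.eq_datumOfRecord₁₁ ▸ hw, hγ⟩

/-- **THE DATUM's β-FUNCTIONS ARE def-B's β OF RECORD AT THE CANONICAL PARAMETER** (`βfun_datumOfRecord₁₁_eq_betaOfRecord₁₁`, `rfl` there) — what the (D4) read-out binders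
and node N17 read off `D`. [cite: Balaban1987RG1, (1.20)–(1.22) p.264 (bookkeeping)] -/
theorem IsDatumOfRecord₁₁C.βfun_eq_betaOfRecord₁₁ (h : IsDatumOfRecord₁₁C F N D) : D.βfun = betaOfRecord₁₁ F N h.params := by
  have := βfun_datumOfRecord₁₁_eq_betaOfRecord₁₁ F N h.params h.provisos
  rwa [← h.eq_datumOfRecord₁₁] at this

/-- A Stage-11 datum of record is a datum of record, Stage 0 (binder B1 ∕ node N23's reading). [cite: Balaban1987RG1, (0.3)–(0.4) p.253 (bookkeeping)] -/
theorem IsDatumOfRecord₁₁C.isDatumOfRecord₀ (h : IsDatumOfRecord₁₁C F N D) : IsDatumOfRecord₀ F N D := by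
  rw [h.eq_datumOfRecord₁₁]
  exact isDatumOfRecord₀_datumOfRecord₁₁ F N h.params h.provisos

/-- **THE ₅C SHADOW AT THE CANONICAL PARAMETER**: a Stage-11 datum of record is refined by a Stage-5 C-bound record at some world (Record11 §8's
`exists_isRecordOfRecord₅C_of_isRecordOfRecord₁₁C` through the world companion) — for consumers keyed at ₅C. [cite: Balaban1989LargeFieldII, Thm 1 + (0.1) pp.355–356 (bookkeeping)] -/
theorem IsDatumOfRecord₁₁C.exists_isRecordOfRecord₅C (h : IsDatumOfRecord₁₁C F N D) :
    ∃ (D₅ : FiniteEpsData F (SU N)) (w : WorldP), IsRecordOfRecord₅C F N D₅ w ∧ D₅.C = D.C ∧ (∀ K g₀ k, D₅.dens K g₀ k = D.dens K g₀ k) ∧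
      D₅.βfun = D.βfun ∧ D₅.av = D.av := by
  obtain ⟨w, hw, -⟩ := h.exists_world_gamma
  obtain ⟨D₅, h₅⟩ := exists_isRecordOfRecord₅C_of_isRecordOfRecord₁₁C hw
  exact ⟨D₅, w, h₅⟩

end DatumKey

/-! ## Canonicalised readings — COHERENCE for records keyed «`∃ θ hP, θ.Admissible ∧ D = datumOfRecord₁₁ F N θ hP ∧ S = cr F θ hP …`»

(T-SPINE)'s `YMDAG.UVSplit.SRec₁₁ cr` (p454411) keys by its own existential witness.  Reading it (and (T-RATE)'s twin) through `canon₁₁ f` below makes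
the admitted bundle a function of the DATUM: `canon₁₁ f θ hP = f h.params h.provisos` whenever `datumOfRecord₁₁ F N θ hP = D` and `h : IsDatumOfRecord₁₁C F N D`
(`canon₁₁_eq_of_eq`), so two records keyed independently but read through `canon₁₁` admit, at the same `(F, D, g₀, os)`, bundles read at the SAME parameter
(`exists_keyed_canon₁₁_iff` turns either key into «`∃ h : IsDatumOfRecord₁₁C F N D, Φ (f h.params h.provisos)`»).  Off the datum-of-record class `canon₁₁ f = f`. -/
section Canon

variable (F : T4Family) (N : ℕ) [NeZero N] {α : Sort*}

/-- **CANONICALISED READING**: read `f` at the canonical parameter of the datum `datumOfRecord₁₁ F N θ hP` when that datum is of record (admissible), else at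
`(θ, hP)` itself.  Kernel bookkeeping (`Classical.dec`, `dite`). [cite: Balaban1989LargeFieldII, Thm 1 + (0.1) pp.355–356 (bookkeeping)] -/
def canon₁₁ (f : (θ : Stage11Params F N) → θ.Provisos₁₁ → α) (θ : Stage11Params F N) (hP : θ.Provisos₁₁) : α := by
  classical
  exact if h : IsDatumOfRecord₁₁C F N (datumOfRecord₁₁ F N θ hP) then f h.params h.provisos else f θ hP

variable {F N}

/-- The canonical parameter depends on the datum only: transport of the key along `D = D'` does not change `.params` (proof irrelevance + `subst`).
[cite: Balaban1989LargeFieldII, Thm 1 + (0.1) pp.355–356 (bookkeeping)] -/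
theorem IsDatumOfRecord₁₁C.params_congr {D D' : FiniteEpsData F (SU N)} (h : IsDatumOfRecord₁₁C F N D) (h' : IsDatumOfRecord₁₁C F N D') (e : D = D') :
    h.params = h'.params := by
  subst e
  rfl

/-- **`canon₁₁ f θ hP = f h.params h.provisos`** whenever `(θ, hP)` realises a datum of record `D` with key `h`. [cite: Balaban1989LargeFieldII, Thm 1 + (0.1) pp.355–356 (bookkeeping)] -/
theorem canon₁₁_eq_of_eq {f : (θ : Stage11Params F N) → θ.Provisos₁₁ → α} {D : FiniteEpsData F (SU N)} (h : IsDatumOfRecord₁₁C F N D)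
    (θ : Stage11Params F N) (hP : θ.Provisos₁₁) (e : D = datumOfRecord₁₁ F N θ hP) :
    canon₁₁ F N f θ hP = f h.params h.provisos := by
  subst e
  unfold canon₁₁
  rw [dif_pos h]

/-- At the canonical parameter itself `canon₁₁ f` reads `f`. [cite: Balaban1989LargeFieldII, Thm 1 + (0.1) pp.355–356 (bookkeeping)] -/
theorem canon₁₁_params {f : (θ : Stage11Params F N) → θ.Provisos₁₁ → α} {D : FiniteEpsData F (SU N)} (h : IsDatumOfRecord₁₁C F N D) :
    canon₁₁ F N f h.params h.provisos = f h.params h.provisos :=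
  canon₁₁_eq_of_eq h h.params h.provisos h.eq_datumOfRecord₁₁

/-- At an admissible tuple with provisos, `canon₁₁ f` reads `f` at the canonical parameter of ITS datum. [cite: Balaban1989LargeFieldII, Thm 1 + (0.1) pp.355–356 (bookkeeping)] -/
theorem canon₁₁_eq_of_admissible {f : (θ : Stage11Params F N) → θ.Provisos₁₁ → α} (θ : Stage11Params F N) (hP : θ.Provisos₁₁) (hθ : θ.Admissible) :
    canon₁₁ F N f θ hP = f (isDatumOfRecord₁₁C_datumOfRecord₁₁ F N θ hP hθ).params (isDatumOfRecord₁₁C_datumOfRecord₁₁ F N θ hP hθ).provisos :=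
  canon₁₁_eq_of_eq _ θ hP rfl

/-- Off the datum-of-record class nothing is canonicalised. [cite: Balaban1989LargeFieldII, Thm 1 + (0.1) pp.355–356 (bookkeeping)] -/
theorem canon₁₁_eq_self_of_not {f : (θ : Stage11Params F N) → θ.Provisos₁₁ → α} (θ : Stage11Params F N) (hP : θ.Provisos₁₁)
    (hn : ¬ IsDatumOfRecord₁₁C F N (datumOfRecord₁₁ F N θ hP)) : canon₁₁ F N f θ hP = f θ hP := by
  unfold canon₁₁
  rw [dif_neg hn]

/-- **THE KEYED-RECORD FACE**: an existentially keyed record («some admissible `θ` with provisos realises `D` and the bundle reads `canon₁₁ f` there») IS the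
datum-keyed record («the bundle reads `f` at the canonical parameter of `D`») — for every property `Φ` of the reading (e.g. `Φ x := S = x g₀ os`). This is the
sentence that makes (T-SPINE)'s `SRec₁₁ (canon₁₁ ∘ cr)` and (T-RATE)'s twin COHERENT. [cite: Balaban1989LargeFieldII, Thm 1 + (0.1) pp.355–356 (bookkeeping)] -/
theorem exists_keyed_canon₁₁_iff {f : (θ : Stage11Params F N) → θ.Provisos₁₁ → α} {D : FiniteEpsData F (SU N)} (Φ : α → Prop) :
    (∃ (θ : Stage11Params F N) (hP : θ.Provisos₁₁), θ.Admissible ∧ D = datumOfRecord₁₁ F N θ hP ∧ Φ (canon₁₁ F N f θ hP)) ↔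
      ∃ h : IsDatumOfRecord₁₁C F N D, Φ (f h.params h.provisos) := by
  constructor
  · rintro ⟨θ, hP, hθ, e, hΦ⟩
    have h : IsDatumOfRecord₁₁C F N D := ⟨θ, hP, hθ, e⟩
    refine ⟨h, ?_⟩
    rwa [canon₁₁_eq_of_eq (f := f) h θ hP e] at hΦ
  · rintro ⟨h, hΦ⟩
    refine ⟨h.params, h.provisos, h.admissible, h.eq_datumOfRecord₁₁, ?_⟩
    rwa [canon₁₁_params (f := f) h]

/-- **COHERENCE**: two existentially keyed records read through `canon₁₁` admit, at the same datum, readings AT THE SAME PARAMETER.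
[cite: Balaban1989LargeFieldII, Thm 1 + (0.1) pp.355–356 (bookkeeping)] -/
theorem keyed_canon₁₁_coherent {β : Sort*} {f : (θ : Stage11Params F N) → θ.Provisos₁₁ → α} {g : (θ : Stage11Params F N) → θ.Provisos₁₁ → β}
    {D : FiniteEpsData F (SU N)} (Φ : α → Prop) (Ψ : β → Prop)
    (hΦ : ∃ (θ : Stage11Params F N) (hP : θ.Provisos₁₁), θ.Admissible ∧ D = datumOfRecord₁₁ F N θ hP ∧ Φ (canon₁₁ F N f θ hP))
    (hΨ : ∃ (θ : Stage11Params F N) (hP : θ.Provisos₁₁), θ.Admissible ∧ D = datumOfRecord₁₁ F N θ hP ∧ Ψ (canon₁₁ F N g θ hP)) :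
    ∃ h : IsDatumOfRecord₁₁C F N D, Φ (f h.params h.provisos) ∧ Ψ (g h.params h.provisos) := by
  obtain ⟨h, h₁⟩ := (exists_keyed_canon₁₁_iff Φ).1 hΦ
  obtain ⟨h', h₂⟩ := (exists_keyed_canon₁₁_iff Ψ).1 hΨ
  exact ⟨h, h₁, h₂⟩

end Canon

end Literature.MathematicalPhysics.QuantumFieldTheory.Balaban1983to89.Node00

end
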